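/-
Copyright (c) 2026 the pub-hodgecm-mathlib formalisation cell (harness21).  Prover seat hodgecm-mathlib-LA3-p01 (g0), «GO 500» half A line L3
(socket `stub_FROB`, road ROOF → `stub_ROOF0`), organ #2 (r-B) «RE-TARGETING AN ISOGENY ROOF ALONG THE RECOGNITION ISOMORPHISM»; 2026-09-02.
-/
import Literature.AlgebraicGeometry.AbelianSchemes.SerreTranslateCoverLeg
import Literature.AlgebraicGeometry.AbelianSchemes.FrobeniusTwistOfRoof
import Literature.AlgebraicGeometry.AbelianSchemes.AbelianSchemeHomDescentPolarized
import Literature.AlgebraicGeometry.AbelianSchemes.TupleIsoAtOfFibreIsoPoints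
import Literature.AlgebraicGeometry.AbelianSchemes.SerreTensorIdealTranslationQuasiInverse
import HarnessLib

/-!
# Re-targeting an isogeny roof `A —q→ B ←c— A″` along a recognition isomorphism `E : C ≅ B` under `A″` (`ψ ≫ E = c`): the leg `q′ := q ≫ E⁻¹ : A → C`
# keeps surjectivity ∕ finiteness, intertwiners, level points and the polarisation law; and `E` for the middle of the P6a roof = a fibre of the Serre family

Topic `AlgebraicGeometry/AbelianSchemes`, namespace `Literature.AlgebraicGeometry.AbelianSchemes.AbelianSchemeOver`.  THEOREMS ONLY (no definition, no named fact,
no `instance`, no notation, no `sorry`).  Cell `hodgecm-mathlib` (D-0151), F0∕P6 «MOD», «GO 500» line L3 (socket `stub_FROB` of the D-line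
`Cruxes/HLiu418/Lines/F0_P6a_DatumOfInputs.lean`), road ROOF → `stub_ROOF0`, organ **(r-B)** of LA3-plan (g0) deal v1 («`RoofΩ`'s abstract middle `B ≅ 𝒞_{y″}` UNDER
`A_{y″}` so that ★ (ν8) `exists_specialFibre_hom_reduction` (p847636) reduces `q′` ONCE for (r1₀)(r3₀-q)(r4₀-q)(r5₀-q)»); sequel of ★ `SerreTranslateCoverLeg` (organ #1,
p847713) and ★ G1b `SerreTensorRecognitionOfPoints` (p846733).  `--supports stmt-HodgeConjecture-24832`, count-neutral.  HONEST LABEL: HC_CM is proved only modulo the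
cell's 2 remaining named inputs (hLiu418 24832, h413 24833) until rung 0 closes; this file discharges none of them.

## Mathematics

The generic part (§1, ANY base `S`; [MumfordAV1970] §7 Thm. 4, §15 Thm. 1, §23): an isogeny roof `A —q→ B ←c— A″` of homomorphisms of abelian `S`-schemes, an fppf
homomorphism `ψ : A″ → C` and an ISOMORPHISM of group schemes `E : C ≅ B` UNDER `A″` (`ψ ≫ E = c`; the RECOGNITION isomorphism of ★ KER-EQ ∕ ★ G1b when `c` and `ψ`
have the same kernel).  RE-TARGET the other leg: `q′ := q ≫ E⁻¹ : A → C`.  Then (i) `q′` is surjective ∕ finite ∕ flat iff `q` is; (ii) a COMMON INTERTWINER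
(`ι_A(a) ≫ q = q ≫ b`, `ι_{A″}(a) ≫ c = c ≫ b`) together with `ψ`-equivariance (`ι_{A″}(a) ≫ ψ = ψ ≫ ι_C(a)`) gives `ι_A(a) ≫ q′ = q′ ≫ ι_C(a)` (cancel the epimorphism
`ψ`: `ι_C(a) ≫ E = E ≫ b`); (iii) a point identity `q(P) = c(P″)` becomes `q′(P) = ψ(P″)`; (iv) POLARISATIONS: if `c^*λ_B = ψ^*λ_C` (both `= n″·λ_{A″}`) and `ψ^∨` is
quasi-invertible then `E` is `λ`-exact (★ polarised recognition `comp_lam_comp_dualIsogenyOver_eq_of_pullback_eq`) and `q^*λ_B = n·λ_A` becomes `q′^*λ_C = n·λ_A`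
(`(q ≫ E⁻¹)^∨ = (E⁻¹)^∨ ≫ q^∨`, `E⁻¹ ≫ λ_C ≫ (E⁻¹)^∨ = λ_B`, ★ `inv_comp_lam_comp_dualIsogenyOver_inv_of_eq`).
The special part (§2; [Conrad2004GrossZagier] §7 Thm. 7.5, [MumfordAV1970] §7 Thm. 4, [Tate1997FiniteFlatGroupSchemes] (3.7)): for the SERRE FAMILY `𝒞 := 𝒜 ⊗_𝒪 𝔟` over
`Y` with its translation `ψ_P` (kernel `𝒜[𝔭]`) and cover `ψ′` (`ψ′ψ_P = [N]`), read at an iterated base change `(· ×_Y Y′) ×_{Y′} x″` to a point `x″ : Spec Ω → Y′` with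
`Ω = Ω̄` of characteristic `0`: a SURJECTIVE homomorphism `c : 𝒜_{x″} → B` with `Ker c(Ω) = 𝒜_{x″}[𝔭](Ω)` ON `Ω`-POINTS (VERBATIM `RoofΩ` (r2) through `fibreΩOf = (schΩOf).toAffine.
toAbelianVariety` and `(actΩOf …).hom.hom.hom = ((ρ.baseChange ι_η).baseChange (ℓ y″).left).i a`, both `rfl`) IS the fibre cover leg `c̄ = (ψ_P ×_Y Y′) ×_{Y′} x″` up to a
UNIQUE isomorphism `E : 𝒞_{x″} ≅ B` under `𝒜_{x″}` (★ G1b at the base-changed action + the two-step bridge `c̄ ≫ β₂ = ψ_P(𝒜_{x″})` of ★ organ #1); and the dual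
quasi-inverse `c̄^∨ ≫ (c̄′)^∨ = [N]` of (iv) is the base change of `ψ′ψ_P = [N]`.

## Contents
* §1 (generic) `surjective_retarget_left`, `isFinite_retarget_left`, `flat_retarget_left`, **`i_comp_retarget_of_common_intertwiner`**, **`map_retarget_eq_map`**,
  **`isExact_recognition_of_pullback_eq`** (`E ≫ λ_B ≫ E^∨ = λ_C`), **`retarget_comp_lam_comp_dualIsogenyOver`** (`q′^*λ_C = n·λ_A`).
* §2 (Serre family at `x″`) **`exists_iso_coverLeg_comp_eq_of_forall_points_of_charZero`** (`∃ E`, `c̄ ≫ E.hom = c`, `IsMonHom E.hom ∧ IsMonHom E.inv`, unique),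
  `coverLegInv_comp_coverLeg` (`c̄′ ≫ c̄ = [N]`), **`dualIsogenyOver_coverLeg_comp_eq_pow_id`** (`c̄^∨ ≫ c̄′^∨ = [N]`).

## References
* [MumfordAV1970] D. Mumford, *Abelian Varieties* (1970), §7 Thm. 4 (p. 72), §15 Thm. 1 (p. 143), §23 Thm. 2 (p. 231).
* [MumfordFogartyKirwan1994] D. Mumford, J. Fogarty, F. Kirwan, *GIT*, 3rd ed. (1994), Ch. 6 §2 Def. 6.3 (p. 120), Ch. 7 §2 Def. 7.1–7.2 (p. 129).
* [Conrad2004GrossZagier] B. Conrad, *Gross–Zagier revisited*, MSRI Publ. 49 (2004), §7 (Thm. 7.5).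
* [Tate1997FiniteFlatGroupSchemes] J. Tate, *Finite flat group schemes* (1997), (3.7).
* [RapoportSmithlingZhang2020Diagonal] M. Rapoport, B. Smithling, W. Zhang (2020), §4.1 (p. 17), §4.3 (4.23) (p. 21).
-/

set_option autoImplicit false

noncomputable section

universe u

open CategoryTheory CategoryTheory.Limits AlgebraicGeometry MonoidalCategory CartesianMonoidalCategory
open scoped MonObj
open Literature.AlgebraicGeometry.Motives (AlgPoints)

namespace Literature.AlgebraicGeometry.AbelianSchemes

namespace AbelianSchemeOver

set_option backward.isDefEq.respectTransparency false

/-! ## §1 Re-targeting a roof leg along an isomorphism under the other vertex (generic) -/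

section Generic

variable {S : Scheme.{u}} {A A'' B C : AbelianSchemeOver S}
  (q : A.X ⟶ B.X) [IsMonHom q] (c : A''.X ⟶ B.X) [IsMonHom c] (ψ : A''.X ⟶ C.X) [IsMonHom ψ]
  (E : C.X ≅ B.X) [IsMonHom E.hom] [IsMonHom E.inv]

omit [IsMonHom q] [IsMonHom E.hom] [IsMonHom E.inv] in
/-- `q′ = q ≫ E⁻¹` is surjective when `q` is. [cite: GortzWedhorn2023, Prop. 27.176] -/
theorem surjective_retarget_left [Surjective q.left] : Surjective (q ≫ E.inv).left := by
  haveI := isIso_left_of_isIso E.inv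
  rw [Over.comp_left]
  exact (MorphismProperty.cancel_right_of_respectsIso (P := @Surjective) q.left E.inv.left).mpr inferInstance

omit [IsMonHom q] [IsMonHom E.hom] [IsMonHom E.inv] in
/-- `q′ = q ≫ E⁻¹` is finite when `q` is. [cite: GortzWedhorn2023, Cor. 27.177 (1)] -/
theorem isFinite_retarget_left [IsFinite q.left] : IsFinite (q ≫ E.inv).left := by
  haveI := isIso_left_of_isIso E.inv
  rw [Over.comp_left]
  exact (MorphismProperty.cancel_right_of_respectsIso (P := @IsFinite) q.left E.inv.left).mpr inferInstance

omit [IsMonHom q] [IsMonHom E.hom] [IsMonHom E.inv] in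
/-- `q′ = q ≫ E⁻¹` is flat when `q` is. [cite: GortzWedhorn2023, Prop. 27.176] -/
theorem flat_retarget_left [Flat q.left] : Flat (q ≫ E.inv).left := by
  haveI := isIso_left_of_isIso E.inv
  rw [Over.comp_left]
  exact (MorphismProperty.cancel_right_of_respectsIso (P := @Flat) q.left E.inv.left).mpr inferInstance

omit [IsMonHom q] [IsMonHom c] [IsMonHom ψ] [IsMonHom E.hom] [IsMonHom E.inv] in
/-- **A COMMON INTERTWINER RE-TARGETS** ((r4) ⟹ (ν8)(ii)'s hypothesis): if `ι_A(a) ≫ q = q ≫ b`, `ι_{A″}(a) ≫ c = c ≫ b` for one endomorphism `b` of `B`, `ψ` is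
`ι`-equivariant (`ι_{A″}(a) ≫ ψ = ψ ≫ ι_C(a)`) and an epimorphism (flat, surjective, quasi-compact), and `ψ ≫ E = c`, then `ι_A(a) ≫ q′ = q′ ≫ ι_C(a)` for `q′ = q ≫ E⁻¹`.
[cite: MumfordAV1970, §7 Thm. 4 (p. 72)] [cite: Kottwitz1992, §5 (p. 391)] -/
theorem i_comp_retarget_of_common_intertwiner [Flat ψ.left] [Surjective ψ.left] [QuasiCompact ψ.left] (hE : ψ ≫ E.hom = c)
    {iA : A.X ⟶ A.X} {iA'' : A''.X ⟶ A''.X} {iC : C.X ⟶ C.X} {b : B.X ⟶ B.X}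
    (hqb : iA ≫ q = q ≫ b) (hcb : iA'' ≫ c = c ≫ b) (hψ : iA'' ≫ ψ = ψ ≫ iC) :
    iA ≫ (q ≫ E.inv) = (q ≫ E.inv) ≫ iC := by
  have h1 : iC ≫ E.hom = E.hom ≫ b := by
    apply A''.cancel_left_of_flat_surjective ψ
    rw [← Category.assoc, ← hψ, Category.assoc, hE, hcb, ← hE, Category.assoc]
  have h2 : b ≫ E.inv = E.inv ≫ iC := comp_inv_eq_inv_comp_of_comp_hom_eq E h1
  rw [← Category.assoc, hqb, Category.assoc, h2, Category.assoc]

omit [IsMonHom q] [IsMonHom c] [IsMonHom ψ] [IsMonHom E.hom] [IsMonHom E.inv] in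
/-- **POINT IDENTITIES RE-TARGET** ((r5) ⟹ (ν8)(iii)'s hypothesis): `q(P) = c(P″)` and `ψ ≫ E = c` give `q′(P) = ψ(P″)` on `L`-valued points (`S = Spec Ω`).
[cite: MumfordFogartyKirwan1994, Ch. 7 §2 Definition 7.1 (p. 129)] -/
theorem map_retarget_eq_map {Ω : Type u} [Field Ω] {A A'' B C : AbelianSchemeOver (Spec (.of Ω))}
    (q : A.X ⟶ B.X) (c : A''.X ⟶ B.X) (ψ : A''.X ⟶ C.X) (E : C.X ≅ B.X) (hE : ψ ≫ E.hom = c)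
    {L : Type u} [Field L] [Algebra Ω L] (P : AlgPoints A.X L) (P'' : AlgPoints A''.X L) (h : AlgPoints.map q P = AlgPoints.map c P'') :
    AlgPoints.map (q ≫ E.inv) P = AlgPoints.map ψ P'' := by
  rw [AlgPoints.map_comp_apply, h, ← hE, AlgPoints.map_comp_apply, ← AlgPoints.map_comp_apply E.hom E.inv, Iso.hom_inv_id,
    AlgPoints.map_id_apply]

variable [IsReduced S] [IsLocallyNoetherian S] (DA : A.DualPair) (DA'' : A''.DualPair) (DB : B.DualPair) (DC : C.DualPair)
  (hDB : Nonempty ((Scheme.Modules.pullback (DualPair.unitHatSlice DB)).obj DB.P ≅ SheafOfModules.unit _))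
  (hDC : Nonempty ((Scheme.Modules.pullback (DualPair.unitHatSlice DC)).obj DC.P ≅ SheafOfModules.unit _))

include hDB hDC in
omit [IsMonHom q] [IsMonHom E.inv] in
/-- **THE RECOGNITION ISOMORPHISM IS `λ`-EXACT** ((r3)-c + the family law ⟹ `E ≫ λ_B ≫ E^∨ = λ_C`): `ψ` fppf with `ψ^∨` quasi-invertible (`ψ^∨ ≫ χ′ = [M]`, `M ≠ 0`),
`ψ ≫ E = c`, and the two pull-backs to `A″` agree: `c ≫ λ_B ≫ c^∨ = λ″ ≫ [n″] = ψ ≫ λ_C ≫ ψ^∨` (★ polarised recognition `comp_lam_comp_dualIsogenyOver_eq_of_pullback_eq`).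
[cite: MumfordAV1970, §23 Thm. 2 (p. 231)] [cite: MumfordAV1970, §15 Thm. 1 (p. 143)] -/
theorem isExact_recognition_of_pullback_eq [Flat ψ.left] [Surjective ψ.left] [QuasiCompact ψ.left] (hE : ψ ≫ E.hom = c)
    (lamA'' : A''.X ⟶ DA''.hat.X) (lamB : B.X ⟶ DB.hat.X) (lamC : C.X ⟶ DC.hat.X) [IsMonHom lamB] [IsMonHom lamC]
    (χ' : DA''.hat.X ⟶ DC.hat.X) {M : ℕ} (hM : M ≠ 0) (hχ : DualPair.dualIsogenyOver ψ DA'' DC ≫ χ' = (𝟙 DC.hat.X) ^ M) {n'' : ℕ}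
    (hc : c ≫ lamB ≫ DualPair.dualIsogenyOver c DA'' DB = lamA'' ≫ DA''.hat.mulN n'')
    (hψl : ψ ≫ lamC ≫ DualPair.dualIsogenyOver ψ DA'' DC = lamA'' ≫ DA''.hat.mulN n'') :
    E.hom ≫ lamB ≫ DualPair.dualIsogenyOver E.hom DC DB = lamC := by
  subst hE
  haveI := DualPair.isMonHom_dualIsogenyOver E.hom DC DB hDB hDC
  refine comp_lam_comp_dualIsogenyOver_eq_of_pullback_eq ψ DA'' DB DC E lamB lamC χ' hM hχ ?_
  rw [hψl, ← hc]

include hDB hDC in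
omit [IsMonHom q] in
/-- **THE POLARISATION LAW RE-TARGETS** ((r3)-q ⟹ (ν8)(iv)'s hypothesis): under the hypotheses of `isExact_recognition_of_pullback_eq`, the law
`q ≫ λ_B ≫ q^∨ = λ_A ≫ [n]` becomes `q′ ≫ λ_C ≫ q′^∨ = λ_A ≫ [n]` for `q′ = q ≫ E⁻¹` (`(q ≫ E⁻¹)^∨ = (E⁻¹)^∨ ≫ q^∨`, `E⁻¹ ≫ λ_C ≫ (E⁻¹)^∨ = λ_B`).
[cite: MumfordAV1970, §15 Thm. 1 (p. 143) and §23 Thm. 2 (p. 231)] [cite: MumfordFogartyKirwan1994, Ch. 6 §2 Definition 6.3 (p. 120)] -/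
theorem retarget_comp_lam_comp_dualIsogenyOver [IsMonHom q] [Flat ψ.left] [Surjective ψ.left] [QuasiCompact ψ.left] (hE : ψ ≫ E.hom = c)
    (lamA : A.X ⟶ DA.hat.X) (lamA'' : A''.X ⟶ DA''.hat.X) (lamB : B.X ⟶ DB.hat.X) (lamC : C.X ⟶ DC.hat.X) [IsMonHom lamB] [IsMonHom lamC]
    (χ' : DA''.hat.X ⟶ DC.hat.X) {M : ℕ} (hM : M ≠ 0) (hχ : DualPair.dualIsogenyOver ψ DA'' DC ≫ χ' = (𝟙 DC.hat.X) ^ M) {n n'' : ℕ}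
    (hq : q ≫ lamB ≫ DualPair.dualIsogenyOver q DA DB = lamA ≫ DA.hat.mulN n)
    (hc : c ≫ lamB ≫ DualPair.dualIsogenyOver c DA'' DB = lamA'' ≫ DA''.hat.mulN n'')
    (hψl : ψ ≫ lamC ≫ DualPair.dualIsogenyOver ψ DA'' DC = lamA'' ≫ DA''.hat.mulN n'') :
    (q ≫ E.inv) ≫ lamC ≫ DualPair.dualIsogenyOver (q ≫ E.inv) DA DC = lamA ≫ DA.hat.mulN n := by
  have hEx : E.hom ≫ lamB ≫ DualPair.dualIsogenyOver E.hom DC DB = lamC :=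
    isExact_recognition_of_pullback_eq c ψ E DA'' DB DC hDB hDC hE lamA'' lamB lamC χ' hM hχ hc hψl
  -- `E⁻¹ ≫ λ_C ≫ (E⁻¹)^∨ = λ_B`
  have hinv : E.inv ≫ lamC ≫ DualPair.dualIsogenyOver E.inv DB DC = lamB :=
    inv_comp_lam_comp_dualIsogenyOver_inv_of_eq DC DB lamC lamB hDB E hEx
  rw [DualPair.dualIsogenyOver_comp q E.inv DA DB DC, ← hq, ← hinv]
  simp only [Category.assoc]

end Generic

/-! ## §2 The recognition isomorphism for the middle of the P6a roof: `B ≅` the fibre of the Serre family at `x″` -/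

section SerreFamily

variable {Y Y' : Scheme.{u}} (g : Y' ⟶ Y) {Ω : Type u} [Field Ω] [IsAlgClosed Ω] (x'' : Spec (.of Ω) ⟶ Y')
  {A : AbelianSchemeOver Y} {O : Type*} [CommRing O] (act : A.RingAction O) [IsCommMonObj A.X]
  {m : ℕ} (E' : Matrix (Fin m) (Fin m) O) (hE' : E' * E' = E') (P : Matrix (Fin m) (Fin 1) O) (Q : Matrix (Fin 1) (Fin m) O) {N : ℕ}
  {B : AbelianSchemeOver (Spec (.of Ω))} (c : ((A.baseChange g).baseChange x'').X ⟶ B.X) [IsMonHom c]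

/-- **THE MIDDLE OF THE ROOF IS THE FIBRE OF THE SERRE FAMILY** (`Ω = Ω̄`, characteristic `0`): a SURJECTIVE homomorphism `c : 𝒜_{x″} → B` with
`Ker c(Ω) = 𝒜_{x″}[𝔭](Ω)` ON `Ω`-POINTS (`RoofΩ` (r2), in the iterated-base-change currency `(𝒜 ×_Y Y′) ×_{Y′} x″` with the base-changed action) IS the cover leg
`c̄ = (ψ_P ×_Y Y′) ×_{Y′} x″` of the family translation up to a unique isomorphism `E : ((𝒜 ⊗ 𝔟) ×_Y Y′) ×_{Y′} x″ ≅ B` UNDER `𝒜_{x″}` (`c̄ ≫ E = c`), a homomorphism both ways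
(★ G1b `exists_iso_serreTranslate_comp_eq_of_forall_points_of_charZero` at the base-changed action, composed with the two-step bridge ★ `coverLeg_comp_baseChangeIso₂_hom`).
[cite: MumfordAV1970, §7 Thm. 4 (p. 72)] [cite: Conrad2004GrossZagier, §7 (Thm. 7.5)] [cite: Tate1997FiniteFlatGroupSchemes, (3.7)] -/
theorem exists_iso_coverLeg_comp_eq_of_forall_points_of_charZero [CharZero Ω] [Surjective c.left]
    (hN : N ≠ 0) (hP : E' * P = P) (hQ : Q * E' = Q)
    (hQP : Q * P = Matrix.scalar (Fin 1) (N : O)) (hPQ : P * Q = Matrix.scalar (Fin m) (N : O) * E')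
    {𝔭 : Ideal O} (h𝔭 : Ideal.span (Set.range fun k => P k 0) = 𝔭)
    (hker : ∀ Pt : ((A.baseChange g).baseChange x'').toAffine.toAbelianVariety.Points Ω,
      (AlgPoints.map c Pt : B.toAffine.toAbelianVariety.Points Ω) = 1 ↔
        ∀ a ∈ 𝔭, (AlgPoints.map (((act.baseChange g).baseChange x'').i a) Pt :
          ((A.baseChange g).baseChange x'').toAffine.toAbelianVariety.Points Ω) = 1) :
    ∃ E : (((serreTensor act E' hE').baseChange g).baseChange x'').X ≅ B.X,
      baseChangeHom (baseChangeHom (serreTranslate act E' hE' P) g) x'' ≫ E.hom = c ∧ IsMonHom E.hom ∧ IsMonHom E.inv ∧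
      ∀ χ : (((serreTensor act E' hE').baseChange g).baseChange x'').X ⟶ B.X,
        baseChangeHom (baseChangeHom (serreTranslate act E' hE' P) g) x'' ≫ χ = c → χ = E.hom := by
  haveI hcomm : IsCommMonObj ((A.baseChange g).baseChange x'').X :=
    @isCommMonObj_baseChange Y' _ x'' (A.baseChange g) (isCommMonObj_baseChange g)
  -- ★ G1b at the base-changed action: `e₁ : 𝒜_{x″} ⊗ 𝔟 ≅ B` with `ψ_P(𝒜_{x″}) ≫ e₁ = c`
  obtain ⟨e₁, he₁, he₁mon, he₁uniq⟩ :=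
    exists_iso_serreTranslate_comp_eq_of_forall_points_of_charZero ((act.baseChange g).baseChange x'') E' hE' P Q c hN hP hQ hQP hPQ h𝔭 hker
  haveI := he₁mon
  -- the two-step bridge `β₂ : ((𝒜 ⊗ 𝔟) ×_Y Y′) ×_{Y′} x″ ≅ 𝒜_{x″} ⊗ 𝔟` with `c̄ ≫ β₂ = ψ_P(𝒜_{x″})`
  haveI := isCommMonObj_baseChange g (A := A)
  let β₂ : (((serreTensor act E' hE').baseChange g).baseChange x'').X ≅
      (@serreTensor _ ((A.baseChange g).baseChange x'') O _ ((act.baseChange g).baseChange x'') hcomm m E' hE').X :=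
    (Over.pullback x'').mapIso (serreTensorBaseChangeIso' g act E' hE') ≪≫
      @serreTensorBaseChangeIso' Y' _ x'' (A.baseChange g) O _ (act.baseChange g) (isCommMonObj_baseChange g) m E' hE'
  have hβ₂ : baseChangeHom (baseChangeHom (serreTranslate act E' hE' P) g) x'' ≫ β₂.hom =
      @serreTranslate _ ((A.baseChange g).baseChange x'') O _ ((act.baseChange g).baseChange x'') hcomm m E' hE' P :=
    coverLeg_comp_baseChangeIso₂_hom g x'' act E' hE' P hP
  have hβ₂mon := isMonHom_baseChangeIso₂ g x'' act E' hE'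
  haveI : IsMonHom β₂.hom := hβ₂mon.1
  haveI : IsMonHom β₂.inv := hβ₂mon.2
  refine ⟨β₂ ≪≫ e₁, ?_, ?_, ?_, ?_⟩
  · rw [Iso.trans_hom, ← Category.assoc, hβ₂, he₁]
  · rw [Iso.trans_hom]; infer_instance
  · haveI : IsMonHom e₁.inv := inferInstance
    rw [Iso.trans_inv]; infer_instance
  · intro χ hχ
    have h1 : @serreTranslate _ ((A.baseChange g).baseChange x'') O _ ((act.baseChange g).baseChange x'') hcomm m E' hE' P ≫ (β₂.inv ≫ χ) = c := by
      rw [← hβ₂, Category.assoc, Iso.hom_inv_id_assoc, hχ]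
    rw [Iso.trans_hom, ← he₁uniq (β₂.inv ≫ χ) h1, Iso.hom_inv_id_assoc]

omit [IsAlgClosed Ω] [IsMonHom c] in
/-- **`c̄′ ≫ c̄ = [N]`**: the cover `c̄′ := (ψ′ ×_Y Y′) ×_{Y′} x″` (★ `serreTranslateInv`) and the translation `c̄` of the Serre family at `x″` form a quasi-inverse pair
(★ `serreTranslateInv_comp_serreTranslate` base-changed twice). [cite: Conrad2004GrossZagier, §7 (Thm. 7.5)] [cite: MumfordAV1970, §7 Thm. 4 (p. 72)] -/
theorem coverLegInv_comp_coverLeg (hP : E' * P = P) (hQ : Q * E' = Q) (hPQ : P * Q = Matrix.scalar (Fin m) (N : O) * E') :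
    baseChangeHom (baseChangeHom (serreTranslateInv act E' hE' Q) g) x'' ≫ baseChangeHom (baseChangeHom (serreTranslate act E' hE' P) g) x'' =
      (𝟙 (((serreTensor act E' hE').baseChange g).baseChange x'').X) ^ N :=
  baseChangeHom_comp_eq_pow_id_of_comp_eq_pow_id x'' _ _
    (baseChangeHom_comp_eq_pow_id_of_comp_eq_pow_id g _ _ (serreTranslateInv_comp_serreTranslate act E' hE' P Q hP hQ hPQ))

omit [IsAlgClosed Ω] [IsMonHom c] in
/-- **`c̄^∨ ≫ (c̄′)^∨ = [N]`** — the quasi-inverse of the DUAL of the cover leg (the `hχ` input of `isExact_recognition_of_pullback_eq` ∕ `retarget_comp_lam_comp_dualIsogenyOver`),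
for any dual pairs of the two fibres with the unit hypothesis on the Serre side (★ `dualIsogenyOver_comp`, ★ `dualIsogenyOver_mulN`).
[cite: MumfordAV1970, §15 Thm. 1 (p. 143)] [cite: Conrad2004GrossZagier, §7 (Thm. 7.5)] -/
theorem dualIsogenyOver_coverLeg_comp_eq_pow_id (hP : E' * P = P) (hQ : Q * E' = Q) (hPQ : P * Q = Matrix.scalar (Fin m) (N : O) * E')
    (DA : ((A.baseChange g).baseChange x'').DualPair) (DC : (((serreTensor act E' hE').baseChange g).baseChange x'').DualPair)
    (hDC : Nonempty ((Scheme.Modules.pullback (DualPair.unitHatSlice DC)).obj DC.P ≅ SheafOfModules.unit _)) :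
    haveI := isMonHom_coverLeg g x'' act E' hE' P
    haveI : IsMonHom (baseChangeHom (baseChangeHom (serreTranslateInv act E' hE' Q) g) x'') :=
      (haveI := isMonHom_serreTranslateInv act E' hE' Q; haveI := isMonHom_baseChangeHom (serreTranslateInv act E' hE' Q) g;
        isMonHom_baseChangeHom _ x'')
    DualPair.dualIsogenyOver (baseChangeHom (baseChangeHom (serreTranslate act E' hE' P) g) x'') DA DC ≫
        DualPair.dualIsogenyOver (baseChangeHom (baseChangeHom (serreTranslateInv act E' hE' Q) g) x'') DC DA =
      (𝟙 DC.hat.X) ^ N := by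
  haveI := isMonHom_coverLeg g x'' act E' hE' P
  haveI := isMonHom_serreTranslateInv act E' hE' Q
  haveI := isMonHom_baseChangeHom (serreTranslateInv act E' hE' Q) g
  haveI : IsMonHom (baseChangeHom (baseChangeHom (serreTranslateInv act E' hE' Q) g) x'') := isMonHom_baseChangeHom _ x''
  haveI : IsCommMonObj (((serreTensor act E' hE').baseChange g).baseChange x'').X := AbelianSchemeOver.isCommMonObj_of_isReduced_base _
  haveI : IsMonHom ((((serreTensor act E' hE').baseChange g).baseChange x'').mulN N) := AbelianSchemeOver.isMonHom_mulN _ N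
  rw [← DualPair.dualIsogenyOver_comp _ _ DC DA DC,
    DualPair.dualIsogenyOver_congr DC DC (ψ₂ := (((serreTensor act E' hE').baseChange g).baseChange x'').mulN N) (h₂ := inferInstance)
      (coverLegInv_comp_coverLeg g x'' act E' hE' P Q hP hQ hPQ),
    DualPair.dualIsogenyOver_mulN DC hDC N, mulN_def]

end SerreFamily

end AbelianSchemeOver

end Literature.AlgebraicGeometry.AbelianSchemes

end
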